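import Summits.ResolutionOfSingularities.ResolutionOfSingularities.Theorems.WeightedInvariantLocalWeightedDropTOT2EndBridge
import Summits.ResolutionOfSingularities.ResolutionOfSingularities.Theorems.WeightedInvariantLocalWeightedDropNCEndgameOrderOne

/-!
# TOT2-LINE, piece S-END CLOSED: the endgame `o ≤ 1` in three variables, BINDER-FREE (R8 instantiated)

Crux item stmt-ResolutionOfSingularities-8899 `WeightedInvariant.LocalWeightedDrop` (route `ResolutionOfSingularities/WeightedInvariant`), ENGINE
skeleton v32, residual `stub_spaceNCRankDrop`, TOT2-LINE v1/v1.1 (res-L1-w43-lead-1).  [OURS · L1 W4.3 · seat res-D-pv-006 (S-END); def-free;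
NOT a statement of any manuscript.]

The binder `hR8` of `…TOT2EndBridge` (`winsIn_of_admissible_of_o_le_one`, `dWinsTo_end_of_rung`) is DISCHARGED at `m = 2` by the TOT rung
R8 `NCTransport.exists_winsIn_orderOne_mul_prod` (`…NCEndgameOrderOne`, strategist sketch res-L1-w43-strat-1 `tot_rung_r8_sketch.lean`):
* `winsIn_of_admissible_of_o_le_one_closed` — every admissibly decorated germ in three variables with `o ≤ 1` is won within finitely many
  rounds of the NC count game (every field);
* **`dWinsTo_end`** — S-END for lead-1's assembly S-ASM: on the state type of admissibly decorated positions
  `{p : MvPowerSeries (Fin (2 + 1)) k × Decoration k 2 // Admissible p.1 p.2}` with germ `τ ↦ τ.1.1`, every state with `o ≤ 1` wins towards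
  «the germ is a normal crossing» (`DWinsTo`, `…NCGameDecoratedWins`).
-/

set_option linter.dupNamespace false -- mandated namespace of this single-conjunct summit

namespace Summit.ResolutionOfSingularities.ResolutionOfSingularities.Theorems

namespace TameFourTupleDrop

open MvPowerSeries Literature.AlgebraicGeometry.Resolution

variable {k : Type} [Field k]

/-- **THE ENDGAME IN ROUNDS, binder-free (three variables, every field)**: every admissibly decorated germ with `o ≤ 1` is won within
finitely many rounds of the NC count game. -/
theorem winsIn_of_admissible_of_o_le_one_closed {b : MvPowerSeries (Fin (2 + 1)) k} {δ : Decoration k 2} (hadm : Admissible b δ)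
    (ho : δ.o ≤ 1) : ∃ n, WinsIn (m := 2) GermIsNC n b :=
  winsIn_of_admissible_of_o_le_one (fun f hf E => NCTransport.exists_winsIn_orderOne_mul_prod f hf E) hadm ho

/-- **S-END (binder-free)**: on the state type of admissibly decorated positions in three variables, every state whose strict transform has
order `≤ 1` wins towards «the germ is a normal crossing». -/
theorem dWinsTo_end (σ : {p : MvPowerSeries (Fin (2 + 1)) k × Decoration k 2 // Admissible p.1 p.2}) (ho : σ.1.2.o ≤ 1) :
    DWinsTo (fun τ : {p : MvPowerSeries (Fin (2 + 1)) k × Decoration k 2 // Admissible p.1 p.2} => τ.1.1)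
      (fun τ => GermIsNC τ.1.1) σ :=
  dWinsTo_end_of_rung (fun f hf E => NCTransport.exists_winsIn_orderOne_mul_prod f hf E) σ ho

end TameFourTupleDrop

end Summit.ResolutionOfSingularities.ResolutionOfSingularities.Theorems
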